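import Summits.CriticalPhenomena.SAWScalingLimit.Theorems.SAWLeftRightFKGFKGToTraversalBoundBBFaceChain
import Summits.CriticalPhenomena.SAWScalingLimit.Theorems.SAWLeftRightFKGFKGToTraversalBoundOutlineTour
import HarnessLib

/-!
# Boundary budget (U6), unit BB5, part 2: lattice connectors along a transported exterior connector

Crux `SAWLeftRightFKG.FKGToTraversalBound` (stmt-CriticalPhenomena-1878), line `slit-necklace`, lead
prover-line-stmt-CriticalPhenomena-1878-c5-0; wave 6 (the BOUNDARY BUDGET), unit BB5 (the four-point lemma
`bb_four_point`), part 2, on top of `…BBFaceChain` (`bb_face_chain`: the non-`A` corners of the closed fine faces met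
by a path avoiding the fine body form a `4`-connected set) and the vocabulary `…SlitNecklaceOutline` / `…OutlineTour`.

Setting: a coarse site set `B`, a refinement factor `M ≥ 2`, the fine body set `A` (given through its BOX description,
its no-pinch property and the avoidance property of `…BBFourPointFacts`), fine mesh `η = δ / M`.

* `bbp_connectors` (registered helper) — given two boundary edges `(x, d)`, `(x', d')` of `B`, a path `π` from a point
  `u` of the coarse segment `[x, x + d]` at distance `> η` from the mesh point of `x` to a point `v` of `[x', x' + d']`
  likewise, such that NO point of `π` has all its sup-norm-close coarse sites in `B`: a finite fine site set
  `X ⊆ Aᶜ`, `4`-connected, containing the two fine contacts `M • x + d`, `M • x' + d'`, all of whose sites are spoke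
  sites `M • x + t • d` (`0 < t`, `t η < dist u x`), or `M • x' + t • d'` likewise, or within sup-distance `η` of a
  point of `π`.  Construction: `bb_face_chain` along `π`, plus the two SPOKES of fine sites on the coarse segments
  from the fine contacts up to the last fine site before `u` (resp. `v`), which is a corner of a fine face containing
  `u` and hence already in the face chain.
* riders `bbp_anchor`, `bbp_close_of_corner` (sup-norm closeness versus corners of closed fine cells),
  `bbp_lineWalk` (straight lattice walks), `bbp_seg_coords` (coordinates on a coarse lattice segment),
  `bbp_spoke_notMem` (spoke sites are not body sites).

All statements folklore (lattice bookkeeping in the plane); no literature fact is introduced; nothing restates the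
crux.
-/

noncomputable section

open Filter Topology Set Metric
open Literature.Probability.LatticeModels
open Literature.Probability.RandomPlanarGeometry
open SimpleGraph

namespace Summit.CriticalPhenomena.SAWScalingLimit.Theorems.FKGToTraversalBound.SlitNecklace

/-! ### Sup-norm closeness of a fine site to a point, and corners of fine cells -/

/-- **Rider.**  A site within sup-distance `η` (one cell, in mesh units) of a point is a corner of a closed `η`-cell
containing the point. [folklore] -/
theorem bbp_anchor {η : ℝ} (p : ℂ) (s : Site 2) (h0 : |η * s 0 - p.re| ≤ η)
    (h1 : |η * s 1 - p.im| ≤ η) :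
    ∃ g : Site 2, ((meshPoint η g).re ≤ p.re ∧ p.re ≤ (meshPoint η g).re + η ∧
      (meshPoint η g).im ≤ p.im ∧ p.im ≤ (meshPoint η g).im + η) ∧
      (s = g ∨ s = g + ODir.vec 0 ∨ s = g + ODir.vec 1 ∨ s = g + ODir.vec 0 + ODir.vec 1) := by
  have key : ∀ (a : ℤ) (r : ℝ), |η * a - r| ≤ η →
      ∃ ε : ℤ, (ε = 0 ∨ ε = 1) ∧ η * ((a - ε : ℤ) : ℝ) ≤ r ∧ r ≤ η * ((a - ε : ℤ) : ℝ) + η := by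
    intro a r h
    rw [abs_le] at h
    by_cases hle : η * a ≤ r
    · exact ⟨0, Or.inl rfl, by push_cast; constructor <;> linarith⟩
    · exact ⟨1, Or.inr rfl, by push_cast; constructor <;> nlinarith⟩
  obtain ⟨ε₀, hε₀, h0a, h0b⟩ := key (s 0) p.re h0
  obtain ⟨ε₁, hε₁, h1a, h1b⟩ := key (s 1) p.im h1
  refine ⟨s - (ε₀ • ODir.vec 0 + ε₁ • ODir.vec 1), ?_, ?_⟩
  · simp only [meshPoint_re, meshPoint_im]
    have e0 : (s - (ε₀ • ODir.vec 0 + ε₁ • ODir.vec 1)) 0 = s 0 - ε₀ := by simp [ODir.vec]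
    have e1 : (s - (ε₀ • ODir.vec 0 + ε₁ • ODir.vec 1)) 1 = s 1 - ε₁ := by simp [ODir.vec]
    rw [e0, e1]
    exact ⟨h0a, h0b, h1a, h1b⟩
  · rcases hε₀ with rfl | rfl <;> rcases hε₁ with rfl | rfl
    · exact Or.inl (by simp)
    · refine Or.inr (Or.inr (Or.inl ?_))
      simp
    · refine Or.inr (Or.inl ?_)
      simp
    · refine Or.inr (Or.inr (Or.inr ?_))
      rw [add_assoc, one_smul, one_smul, sub_add_cancel]

/-- **Rider.**  A corner of a closed `η`-cell containing `p` is within sup-distance `η` of `p`. [folklore] -/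
theorem bbp_close_of_corner {η : ℝ} (hη : 0 < η) {p : ℂ} {g s : Site 2}
    (hin : (meshPoint η g).re ≤ p.re ∧ p.re ≤ (meshPoint η g).re + η ∧
      (meshPoint η g).im ≤ p.im ∧ p.im ≤ (meshPoint η g).im + η)
    (hs : s = g ∨ s = g + ODir.vec 0 ∨ s = g + ODir.vec 1 ∨ s = g + ODir.vec 0 + ODir.vec 1) :
    |η * s 0 - p.re| ≤ η ∧ |η * s 1 - p.im| ≤ η := by
  simp only [meshPoint_re, meshPoint_im] at hin
  obtain ⟨h1, h2, h3, h4⟩ := hin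
  have hη' := hη.le
  rcases hs with rfl | rfl | rfl | rfl <;> refine ⟨abs_le.2 ⟨?_, ?_⟩, abs_le.2 ⟨?_, ?_⟩⟩ <;>
    simp [ODir.vec] <;> linarith

/-! ### Straight walks and spokes -/

/-- **Rider.**  A straight lattice walk of `n` steps in direction `d`; its support consists of the intermediate
sites. [folklore] -/
theorem bbp_lineWalk (f : Site 2) (d : ODir) : ∀ n : ℕ, ∃ w : (zdGraph 2).Walk f (f + (n : ℤ) • d.vec),
    ∀ z ∈ w.support, ∃ k : ℕ, k ≤ n ∧ z = f + (k : ℤ) • d.vec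
  | 0 => ⟨Walk.nil.copy rfl (by simp), fun z hz => ⟨0, le_rfl, by simpa using hz⟩⟩
  | n + 1 => by
    obtain ⟨w, hw⟩ := bbp_lineWalk f d n
    have hadj : (zdGraph 2).Adj (f + (n : ℤ) • d.vec) (f + ((n + 1 : ℕ) : ℤ) • d.vec) := by
      have : f + ((n + 1 : ℕ) : ℤ) • d.vec = f + (n : ℤ) • d.vec + d.vec := by
        push_cast
        rw [add_smul, one_smul, add_assoc]
      rw [this]
      exact ODir.adj_add_vec _ d
    refine ⟨w.append (Walk.cons hadj Walk.nil), fun z hz => ?_⟩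
    rw [Walk.mem_support_append_iff] at hz
    rcases hz with hz | hz
    · obtain ⟨k, hk, rfl⟩ := hw z hz
      exact ⟨k, by omega, rfl⟩
    · simp only [Walk.support_cons, Walk.support_nil, List.mem_cons, List.not_mem_nil, or_false] at hz
      rcases hz with rfl | rfl
      · exact ⟨n, by omega, rfl⟩
      · exact ⟨n + 1, le_rfl, rfl⟩

/-- **Rider.**  Coordinates and distance of a point of the coarse lattice segment from `x` to `x + d` at mesh `δ`.
[folklore] -/
theorem bbp_seg_coords {δ : ℝ} (hδ : 0 < δ) {x : Site 2} {d : ODir} {u : ℂ}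
    (hu : u ∈ segment ℝ (meshPoint δ x) (meshPoint δ (x + d.vec))) :
    ∃ σ : ℝ, 0 ≤ σ ∧ σ ≤ 1 ∧ u.re = δ * x 0 + σ * δ * d.vec 0 ∧ u.im = δ * x 1 + σ * δ * d.vec 1 ∧
      dist u (meshPoint δ x) = σ * δ := by
  rw [segment_eq_image'] at hu
  obtain ⟨σ, ⟨h0, h1⟩, rfl⟩ := hu
  have hdiff : meshPoint δ (x + d.vec) - meshPoint δ x = (δ : ℂ) * Site.toComplex d.vec := by
    apply Complex.ext <;> simp [meshPoint] <;> ring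
  have hnorm : ‖Site.toComplex d.vec‖ = 1 := by
    fin_cases d <;> simp [Site.toComplex, ODir.vec, Complex.norm_eq_sqrt_sq_add_sq]
  refine ⟨σ, h0, h1, ?_, ?_, ?_⟩
  · simp
    ring
  · simp
    ring
  · rw [Complex.dist_eq, add_sub_cancel_left, hdiff, norm_smul, norm_mul, hnorm, Complex.norm_real,
      Real.norm_of_nonneg h0, Real.norm_of_nonneg hδ.le, mul_one]

/-- **Rider.**  Spoke sites (fine sites strictly between `M • x` and `M • (x + d)`, and `M • (x + d)` itself) of a
coarse boundary edge `(x, d)` (`x + d ∉ B`) are not fine body sites. [folklore] -/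
theorem bbp_spoke_notMem {B A : Finset (Site 2)} {M : ℕ}
    (hA : ∀ f : Site 2, f ∈ A ↔ ∀ z : Site 2, (∀ i, |(M : ℤ) * z i - f i| < M) → z ∈ B)
    {x : Site 2} {d : ODir} (hc : x + d.vec ∉ B) {t : ℤ} (ht0 : 0 < t) (htM : t ≤ M) :
    (M : ℤ) • x + t • d.vec ∉ A := by
  intro h
  refine hc ((hA _).1 h (x + d.vec) fun i => ?_)
  simp only [Pi.add_apply, Pi.smul_apply, smul_eq_mul]
  rw [show (M : ℤ) * (x i + d.vec i) - (M * x i + t * d.vec i) = (M - t) * d.vec i by ring, abs_mul,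
    abs_of_nonneg (by omega : (0 : ℤ) ≤ M - t)]
  calc (M - t : ℤ) * |d.vec i| ≤ (M - t) * 1 :=
        mul_le_mul_of_nonneg_left (ODir.abs_vec_apply_le d i) (by omega)
    _ < M := by omega

/-- **The spoke at one end.**  Extend a `4`-connected fine set `X₀ ⊆ Aᶜ` that contains every non-`A` site within
sup-distance `η` of the point `u` (on the coarse segment `[x, x + d]`, `x + d ∉ B`, at distance `> η` from `x`) by the
spoke sites `M • x + t • d`, `1 ≤ t`, `t η < dist u x`: the result is still `4`-connected and `⊆ Aᶜ`, and it contains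
the fine contact `M • x + d`. [folklore] -/
private theorem bbp_spoke {B A : Finset (Site 2)} {M : ℕ} {δ : ℝ} (hM : 2 ≤ M) (hδ : 0 < δ)
    (hA : ∀ f : Site 2, f ∈ A ↔ ∀ z : Site 2, (∀ i, |(M : ℤ) * z i - f i| < M) → z ∈ B)
    {x : Site 2} {d : ODir} (hc : x + d.vec ∉ B) {u : ℂ}
    (hu : u ∈ segment ℝ (meshPoint δ x) (meshPoint δ (x + d.vec))) (hu' : δ / M < dist u (meshPoint δ x))
    (X₀ : Finset (Site 2)) (hX₀A : ∀ s ∈ X₀, s ∉ A)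
    (hX₀c : ∀ s ∈ X₀, ∀ s' ∈ X₀, ∃ w : (zdGraph 2).Walk s s', ∀ z ∈ w.support, z ∈ X₀)
    (hX₀u : ∀ s : Site 2, s ∉ A → |δ / M * s 0 - u.re| ≤ δ / M → |δ / M * s 1 - u.im| ≤ δ / M → s ∈ X₀) :
    ∃ X : Finset (Site 2), X₀ ⊆ X ∧ (∀ s ∈ X, s ∉ A) ∧
      (∀ s ∈ X, ∀ s' ∈ X, ∃ w : (zdGraph 2).Walk s s', ∀ z ∈ w.support, z ∈ X) ∧
      (M : ℤ) • x + d.vec ∈ X ∧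
      ∀ s ∈ X, s ∈ X₀ ∨ ∃ t : ℤ, 0 < t ∧ (t : ℝ) * (δ / M) < dist u (meshPoint δ x) ∧
        s = (M : ℤ) • x + t • d.vec := by
  classical
  have hM0 : (0 : ℝ) < M := by exact_mod_cast (show 0 < M by omega)
  obtain ⟨σ, hσ0, hσ1, hure, huim, hdist⟩ := bbp_seg_coords hδ hu
  set η : ℝ := δ / M with hη_def
  have hη : 0 < η := div_pos hδ hM0
  have hδη : δ = M * η := by rw [hη_def]; field_simp
  set τ : ℝ := σ * M with hτ_def
  have hτ : dist u (meshPoint δ x) = τ * η := by rw [hdist, hδη]; ring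
  have hτ1 : 1 < τ := by
    rw [hτ] at hu'
    by_contra h
    push Not at h
    have : τ * η ≤ 1 * η := mul_le_mul_of_nonneg_right h hη.le
    linarith
  have hτM : τ ≤ M := by rw [hτ_def]; nlinarith
  set T : ℤ := ⌈τ⌉ - 1 with hT_def
  have hT1 : 1 ≤ T := by
    have : (1 : ℤ) < ⌈τ⌉ := Int.lt_ceil.2 (by exact_mod_cast hτ1)
    omega
  have hTτ : (T : ℝ) < τ := by
    have := Int.ceil_lt_add_one τ
    rw [hT_def]
    push_cast
    linarith
  have hτT : τ ≤ T + 1 := by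
    have := Int.le_ceil τ
    rw [hT_def]
    push_cast
    linarith
  have hTM : T < M := by
    have : (T : ℝ) < M := lt_of_lt_of_le hTτ hτM
    exact_mod_cast this
  -- the spoke
  set S : Finset (Site 2) := (Finset.Icc 1 T).image fun t : ℤ => (M : ℤ) • x + t • d.vec with hS_def
  have hSmem : ∀ s, s ∈ S ↔ ∃ t : ℤ, 1 ≤ t ∧ t ≤ T ∧ s = (M : ℤ) • x + t • d.vec := by
    intro s
    simp only [hS_def, Finset.mem_image, Finset.mem_Icc]
    constructor
    · rintro ⟨t, ⟨h1, h2⟩, rfl⟩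
      exact ⟨t, h1, h2, rfl⟩
    · rintro ⟨t, h1, h2, rfl⟩
      exact ⟨t, ⟨h1, h2⟩, rfl⟩
  have hSA : ∀ s ∈ S, s ∉ A := by
    intro s hs
    obtain ⟨t, h1, h2, rfl⟩ := (hSmem s).1 hs
    exact bbp_spoke_notMem hA hc (by omega) (by omega)
  -- the last spoke site lies in `X₀`
  have htop : (M : ℤ) • x + T • d.vec ∈ X₀ := by
    have habs : |η * ((T : ℝ) - τ)| ≤ η := by
      rw [abs_mul, abs_of_pos hη, abs_of_nonpos (by linarith)]
      nlinarith
    refine hX₀u _ (bbp_spoke_notMem hA hc (by omega) hTM.le) ?_ ?_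
    · have : η * (((M : ℤ) • x + T • d.vec) 0 : ℤ) - u.re = η * ((T : ℝ) - τ) * d.vec 0 := by
        rw [hure, hδη, hτ_def]
        simp only [Pi.add_apply, Pi.smul_apply, smul_eq_mul]
        push_cast
        field_simp
        ring
      rw [this, abs_mul]
      calc |η * ((T : ℝ) - τ)| * |(d.vec 0 : ℝ)| ≤ η * 1 :=
            mul_le_mul habs (by exact_mod_cast ODir.abs_vec_apply_le d 0) (abs_nonneg _) hη.le
        _ = η := mul_one η
    · have : η * (((M : ℤ) • x + T • d.vec) 1 : ℤ) - u.im = η * ((T : ℝ) - τ) * d.vec 1 := by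
        rw [huim, hδη, hτ_def]
        simp only [Pi.add_apply, Pi.smul_apply, smul_eq_mul]
        push_cast
        field_simp
        ring
      rw [this, abs_mul]
      calc |η * ((T : ℝ) - τ)| * |(d.vec 1 : ℝ)| ≤ η * 1 :=
            mul_le_mul habs (by exact_mod_cast ODir.abs_vec_apply_le d 1) (abs_nonneg _) hη.le
        _ = η := mul_one η
  -- walks along the spoke to the last spoke site
  have hwalkS : ∀ s ∈ S, ∃ w : (zdGraph 2).Walk s ((M : ℤ) • x + T • d.vec), ∀ z ∈ w.support, z ∈ S := by
    intro s hs
    obtain ⟨t, h1, h2, rfl⟩ := (hSmem s).1 hs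
    obtain ⟨w, hw⟩ := bbp_lineWalk ((M : ℤ) • x + t • d.vec) d (T - t).toNat
    have hend : (M : ℤ) • x + t • d.vec + (((T - t).toNat : ℕ) : ℤ) • d.vec = (M : ℤ) • x + T • d.vec := by
      rw [Int.toNat_of_nonneg (by omega), add_assoc, ← add_smul, add_sub_cancel]
    refine ⟨w.copy rfl hend, fun z hz => ?_⟩
    rw [Walk.support_copy] at hz
    obtain ⟨k, hk, rfl⟩ := hw z hz
    refine (hSmem _).2 ⟨t + k, by omega, ?_, by rw [add_assoc, ← add_smul]⟩
    have : (k : ℤ) ≤ T - t := by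
      have := Int.toNat_of_nonneg (show 0 ≤ T - t by omega)
      omega
    omega
  -- walks to the last spoke site from anywhere in `X₀ ∪ S`
  have hwalk : ∀ s ∈ X₀ ∪ S, ∃ w : (zdGraph 2).Walk s ((M : ℤ) • x + T • d.vec),
      ∀ z ∈ w.support, z ∈ X₀ ∪ S := by
    intro s hs
    rcases Finset.mem_union.1 hs with hs | hs
    · obtain ⟨w, hw⟩ := hX₀c s hs _ htop
      exact ⟨w, fun z hz => Finset.mem_union_left _ (hw z hz)⟩
    · obtain ⟨w, hw⟩ := hwalkS s hs
      exact ⟨w, fun z hz => Finset.mem_union_right _ (hw z hz)⟩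
  refine ⟨X₀ ∪ S, Finset.subset_union_left, fun s hs => ?_, fun s hs s' hs' => ?_,
    Finset.mem_union_right _ ((hSmem _).2 ⟨1, le_rfl, hT1, by rw [one_smul]⟩), fun s hs => ?_⟩
  · rcases Finset.mem_union.1 hs with hs | hs
    · exact hX₀A s hs
    · exact hSA s hs
  · obtain ⟨w, hw⟩ := hwalk s hs
    obtain ⟨w', hw'⟩ := hwalk s' hs'
    refine ⟨w.append w'.reverse, fun z hz => ?_⟩
    rw [Walk.mem_support_append_iff, Walk.support_reverse, List.mem_reverse] at hz
    rcases hz with hz | hz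
    · exact hw z hz
    · exact hw' z hz
  · rcases Finset.mem_union.1 hs with hs | hs
    · exact Or.inl hs
    · obtain ⟨t, h1, h2, rfl⟩ := (hSmem s).1 hs
      refine Or.inr ⟨t, by omega, ?_, rfl⟩
      rw [hτ]
      have : (t : ℝ) ≤ T := by exact_mod_cast h2
      nlinarith

/-! ### The registered helper -/

/-- **U6 BB5, part 2 (registered helper): lattice connectors along a path avoiding the coarse body.**  Given the fine
body set `A` of `B` (box description, no pinch, avoidance), two boundary edges `(x, d)`, `(x', d')` of `B`, and a path
`π` from a point `u ∈ [x, x + d]` with `dist u x > δ / M` to a point `v ∈ [x', x' + d']` likewise, none of whose points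
has all its sup-norm-close coarse sites in `B`: there is a finite `4`-connected fine set `X ⊆ Aᶜ` containing both fine
contacts `M • x + d`, `M • x' + d'`, every site of which is a spoke site of one of the two edges below `u` / `v` or
lies within sup-distance `δ / M` of a point of `π`. [folklore] -/
theorem bbp_connectors : ∀ (B A : Finset (Site 2)) (δ : ℝ) (M : ℕ) (x x' : Site 2) (d d' : ODir) (u v : ℂ) (π : Path u v), 0 < δ → 2 ≤ M → (∀ f : Site 2, f ∈ A ↔ ∀ z : Site 2, (∀ i, |(M : ℤ) * z i - f i| < M) → z ∈ B) → (∀ f : Site 2, (f ∈ A → f + ODir.vec 0 + ODir.vec 1 ∈ A → f + ODir.vec 0 ∈ A ∨ f + ODir.vec 1 ∈ A) ∧ (f + ODir.vec 0 ∈ A → f + ODir.vec 1 ∈ A → f ∈ A ∨ f + ODir.vec 0 + ODir.vec 1 ∈ A)) → (∀ p : ℂ, (¬ ∀ z : Site 2, |p.re - δ * z 0| < δ → |p.im - δ * z 1| < δ → z ∈ B) → (∀ f ∈ A, p ≠ meshPoint (δ / M) f) ∧ (∀ f ∈ A, ∀ d : ODir, f + d.vec ∈ A → p ∉ segment ℝ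 (meshPoint (δ / M) f) (meshPoint (δ / M) (f + d.vec))) ∧ (∀ f : Site 2, f ∈ A → f + ODir.vec 0 ∈ A → f + ODir.vec 1 ∈ A → f + ODir.vec 0 + ODir.vec 1 ∈ A → ¬ ((meshPoint (δ / M) f).re ≤ p.re ∧ p.re ≤ (meshPoint (δ / M) f).re + δ / M ∧ (meshPoint (δ / M) f).im ≤ p.im ∧ p.im ≤ (meshPoint (δ / M) f).im + δ / M))) → x + d.vec ∉ B → x' + d'.vec ∉ B → u ∈ segment ℝ (meshPoint δ x) (meshPoint δ (x + d.vec)) → δ / M < dist u (meshPoint δ x) → v ∈ segment ℝ (meshPoint δ x') (meshPoint δ (x' + d'.vec)) → δ / M < dist v (meshPoint δ x') → (∀ t, ¬ ∀ z : Site 2, |(π t).re - δ * z 0| < δ → |(π t).im - δ * z 1| < δ → z ∈ B) → ∃ X : Finset (Site 2), (∀ s ∈ X, s ∉ A) ∧ (∀ s ∈ X, ∀ s' ∈ X, ∃ w : (zdGraph 2).Walk s s', ∀ z ∈ w.support, z ∈ X) ∧ (M : ℤ) • x + d.vec ∈ X ∧ (M : ℤ) • x' + d'.vec ∈ X ∧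 ∀ s ∈ X, (∃ t : ℤ, 0 < t ∧ (t : ℝ) * (δ / M) < dist u (meshPoint δ x) ∧ s = (M : ℤ) • x + t • d.vec) ∨ (∃ t : ℤ, 0 < t ∧ (t : ℝ) * (δ / M) < dist v (meshPoint δ x') ∧ s = (M : ℤ) • x' + t • d'.vec) ∨ (∃ t : unitInterval, |δ / M * s 0 - (π t).re| ≤ δ / M ∧ |δ / M * s 1 - (π t).im| ≤ δ / M) := by
  intro B A δ M x x' d d' u v π hδ hM hA hnp havoid hc hc' hu hu' hv hv' hπ
  have hη : 0 < δ / M := div_pos hδ (by exact_mod_cast (show 0 < M by omega))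
  obtain ⟨Xπ, hXπA, hXπc, hXπin, hXπnear⟩ := bb_face_chain A (δ / M) π hη hnp
    (fun t f hf => (havoid (π t) (hπ t)).1 f hf) (fun t f hf d'' hfd => (havoid (π t) (hπ t)).2.1 f hf d'' hfd)
    (fun t f hf h0 h1 h01 => (havoid (π t) (hπ t)).2.2 f hf h0 h1 h01)
  have hclose : ∀ (p : ℂ) (t : unitInterval), π t = p → ∀ s : Site 2, s ∉ A →
      |δ / M * s 0 - p.re| ≤ δ / M → |δ / M * s 1 - p.im| ≤ δ / M → s ∈ Xπ := by
    rintro p t rfl s hs h0 h1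
    obtain ⟨g, hg, hsg⟩ := bbp_anchor (π t) s h0 h1
    exact hXπin g s t hg hsg hs
  obtain ⟨X₁, hX₁sub, hX₁A, hX₁c, hX₁e, hX₁cases⟩ :=
    bbp_spoke hM hδ hA hc hu hu' Xπ hXπA hXπc (hclose u 0 π.source)
  obtain ⟨X, hXsub, hXA, hXc, hXe, hXcases⟩ := bbp_spoke hM hδ hA hc' hv hv' X₁ hX₁A hX₁c
    (fun s hs h0 h1 => hX₁sub (hclose v 1 π.target s hs h0 h1))
  refine ⟨X, hXA, hXc, hXsub hX₁e, hXe, fun s hs => ?_⟩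
  rcases hXcases s hs with hs | hs
  · rcases hX₁cases s hs with hs | hs
    · obtain ⟨g, t, hg, hsg⟩ := hXπnear s hs
      exact Or.inr (Or.inr ⟨t, bbp_close_of_corner hη hg hsg⟩)
    · exact Or.inl hs
  · exact Or.inr (Or.inl hs)

end Summit.CriticalPhenomena.SAWScalingLimit.Theorems.FKGToTraversalBound.SlitNecklace

end
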